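import Summits.ValiantsHypothesis.ValiantsHypothesis.Theses.RigidMinimalReps
import Summits.ValiantsHypothesis.ValiantsHypothesis.Theorems.HubHub
import Summits.ValiantsHypothesis.ValiantsHypothesis.Theorems.FreeSubtorusConfusionCoveringKappa

/-!
# Route RigidMinimalReps — item `ExpDcGlue` (stmt-ValiantsHypothesis-5116)

Support item of route `RigidMinimalReps` (the same statement is the unfolded `Assembly` of the
closed route `GrenetRigidity`, `DcPerExponential → ValiantsHypothesis`):

  `(∃ c : ℝ, 1 < c ∧ ∃ n₀, ∀ n ≥ n₀, c ^ n ≤ dc(per_n)) → VP_ℂ ≠ VNP_ℂ`.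

Proof (bookkeeping over results proved in the tree, plus elementary arithmetic):

* `exists_ge_qpExp_lt` — the explicit gap point of the quasi-polynomial template: for all `a, n₀`
  there is `N ≥ n₀` with `(log₂ N + a) ^ a < N` (take `N = 2 ^ (2 ^ k)`, `k = 2a + 2 + n₀`).
* `not_isQPBounded_of_eventually_ge_pow` — an eventual REAL exponential lower bound `c ^ n ≤ t n`
  (`c > 1`) makes `t : ℕ → ℕ` not quasi-polynomially bounded: choose `j` with `2 ≤ c ^ (2 ^ j)`
  (Archimedes); then `2 ^ N ≤ c ^ (2 ^ j * N) ≤ t (2 ^ j * N) ≤ 2 ^ ((log₂ (2 ^ j * N) + a) ^ a)`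
  and `log₂ (2 ^ j * N) ≤ log₂ N + j + 1`, contradicting the gap point for the constant
  `a + j + 1`. (The `ℕ`-shaped special case `2 ^ n - 1 ≤ t n` is
  `Theorems/DetqpThesis/Negative/NotQPBoundedOfExp.lean`.)
* `expDcGlue_proof` — with `t n = dc(per_n)`: `VP ⟹ dc quasi-polynomially bounded`
  (`isQPBounded_determinantalComplexity_of_isVPFamily_holds`; Bürgisser–Clausen–Shokrollahi 1997,
  Cor. (21.40)) shows the permanent family is not a `VP` family, and the hub lemma
  `Summit.ValiantsHypothesis.Hub.valiantsHypothesis_of_not_isVPFamily_per` (`Theorems/HubHub.lean`)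
  fed with the renaming bridge `mem_VP_ofFintype_iff_holds` and Valiant's theorem
  `perFamily_mem_VNP_holds ℂ` (`per ∈ VNP`) gives `VP ℂ ≠ VNP ℂ`.
-/

namespace Summit.ValiantsHypothesis.Theorems

open Literature.Computability.AlgebraicComplexity

/-- Logarithm of a multiple of a power of two: `log₂ (2 ^ j * N) ≤ log₂ N + (j + 1)`. [folklore] -/
theorem log_two_pow_mul_le (j N : ℕ) : Nat.log 2 (2 ^ j * N) ≤ Nat.log 2 N + (j + 1) := by
  have hN : N < 2 ^ (Nat.log 2 N + 1) := Nat.lt_pow_succ_log_self Nat.one_lt_two N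
  have h1 : 2 ^ j * N ≤ 2 ^ (Nat.log 2 N + (j + 1)) := by
    calc 2 ^ j * N ≤ 2 ^ j * 2 ^ (Nat.log 2 N + 1) := Nat.mul_le_mul_left _ hN.le
      _ = 2 ^ (Nat.log 2 N + (j + 1)) := by rw [← pow_add]; congr 1; omega
  calc Nat.log 2 (2 ^ j * N) ≤ Nat.log 2 (2 ^ (Nat.log 2 N + (j + 1))) := Nat.log_mono_right h1
    _ = Nat.log 2 N + (j + 1) := Nat.log_pow Nat.one_lt_two _

/-- Linear versus exponential: `(2a + 2 + i + 1) · a < 2 ^ (2a + 2 + i)`. [folklore] -/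
theorem succ_mul_lt_two_pow_aux (a i : ℕ) : (2 * a + 2 + i + 1) * a < 2 ^ (2 * a + 2 + i) := by
  have ha : a < 2 ^ a := Nat.lt_two_pow_self
  have hj : 2 * a + 2 + i + 1 ≤ 2 ^ (a + 2 + i) := by
    have h1 : a + 1 + i < 2 ^ (a + 1 + i) := Nat.lt_two_pow_self
    have h2 : 2 ^ (a + 2 + i) = 2 * 2 ^ (a + 1 + i) := by
      rw [← pow_succ']; congr 1; omega
    omega
  calc (2 * a + 2 + i + 1) * a ≤ 2 ^ (a + 2 + i) * a := Nat.mul_le_mul_right a hj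
    _ < 2 ^ (a + 2 + i) * 2 ^ a := Nat.mul_lt_mul_of_pos_left ha (Nat.two_pow_pos _)
    _ = 2 ^ (2 * a + 2 + i) := by rw [← pow_add]; congr 1; omega

/-- **The explicit gap point of the quasi-polynomial template.** For every constant `a` and every
`n₀` there is `N ≥ n₀` with `(log₂ N + a) ^ a < N`: at `N = 2 ^ (2 ^ k)` with `k = 2a + 2 + n₀`
one has `(2 ^ k + a) ^ a ≤ (2 · 2 ^ k) ^ a = 2 ^ ((k + 1) a) < 2 ^ (2 ^ k)` since
`(k + 1) a < 2 ^ k`. [folklore] -/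
theorem exists_ge_qpExp_lt (a n₀ : ℕ) : ∃ N, n₀ ≤ N ∧ (Nat.log 2 N + a) ^ a < N := by
  have hk : 2 * a + 2 + n₀ < 2 ^ (2 * a + 2 + n₀) := Nat.lt_two_pow_self
  have hkk : 2 ^ (2 * a + 2 + n₀) < 2 ^ (2 ^ (2 * a + 2 + n₀)) := Nat.lt_two_pow_self
  refine ⟨2 ^ (2 ^ (2 * a + 2 + n₀)), by omega, ?_⟩
  rw [Nat.log_pow Nat.one_lt_two]
  have hka : (2 * a + 2 + n₀ + 1) * a < 2 ^ (2 * a + 2 + n₀) := succ_mul_lt_two_pow_aux a n₀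
  calc (2 ^ (2 * a + 2 + n₀) + a) ^ a ≤ (2 * 2 ^ (2 * a + 2 + n₀)) ^ a :=
        Nat.pow_le_pow_left (by omega) a
    _ = 2 ^ ((2 * a + 2 + n₀ + 1) * a) := by rw [← pow_succ', ← pow_mul]
    _ < 2 ^ (2 ^ (2 * a + 2 + n₀)) := Nat.pow_lt_pow_right (by norm_num) hka

/-- **Real exponential lower bounds eventually ⇒ not qp-bounded.** If `c > 1` is real and
`c ^ n ≤ t n` for all large `n`, then `t : ℕ → ℕ` is not quasi-polynomially bounded
(`2 ^ {(log₂ n + a) ^ a} = 2 ^ {polylog n} = o(c ^ n)`). Proof: pick `j` with `2 ≤ c ^ (2 ^ j)`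
(Archimedes); a qp bound with constant `a` would give, at the gap point `N ≥ n₀` of the constant
`a + (j + 1)`, the chain `2 ^ N ≤ (c ^ (2 ^ j)) ^ N = c ^ (2 ^ j * N) ≤ t (2 ^ j * N) ≤
2 ^ ((log₂ (2 ^ j * N) + a) ^ a) ≤ 2 ^ ((log₂ N + (a + j + 1)) ^ (a + j + 1)) < 2 ^ N`. [folklore] -/
theorem not_isQPBounded_of_eventually_ge_pow {t : ℕ → ℕ} {c : ℝ} (hc : 1 < c)
    (h : ∃ n₀ : ℕ, ∀ n ≥ n₀, c ^ n ≤ (t n : ℝ)) : ¬ IsQPBounded t := by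
  rintro ⟨a, ha⟩
  obtain ⟨n₀, h⟩ := h
  -- a power of two `2 ^ j` with `2 ≤ c ^ (2 ^ j)` (Archimedes, then monotonicity in the exponent)
  obtain ⟨j, hj⟩ : ∃ j : ℕ, (2 : ℝ) ≤ c ^ (2 ^ j) := by
    obtain ⟨i, hi⟩ := pow_unbounded_of_one_lt (2 : ℝ) hc
    exact ⟨i, hi.le.trans (pow_le_pow_right₀ hc.le Nat.lt_two_pow_self.le)⟩
  obtain ⟨N, hN, hgap⟩ := exists_ge_qpExp_lt (a + (j + 1)) n₀
  have hNn : n₀ ≤ 2 ^ j * N := hN.trans (Nat.le_mul_of_pos_left N (Nat.two_pow_pos j))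
  -- the lower bound along the subsequence `2 ^ j * N`
  have hreal : (2 : ℝ) ^ N ≤ (t (2 ^ j * N) : ℝ) :=
    calc (2 : ℝ) ^ N ≤ (c ^ (2 ^ j)) ^ N := pow_le_pow_left₀ (by norm_num) hj N
      _ = c ^ (2 ^ j * N) := (pow_mul c (2 ^ j) N).symm
      _ ≤ t (2 ^ j * N) := h _ hNn
  have hlow : 2 ^ N ≤ t (2 ^ j * N) := by exact_mod_cast hreal
  -- the qp upper bound at the same point, pushed below `2 ^ N` by the gap point
  have hlog := log_two_pow_mul_le j N
  have hexp : (Nat.log 2 (2 ^ j * N) + a) ^ a ≤ (Nat.log 2 N + (a + (j + 1))) ^ (a + (j + 1)) :=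
    calc (Nat.log 2 (2 ^ j * N) + a) ^ a ≤ (Nat.log 2 N + (a + (j + 1))) ^ a :=
          Nat.pow_le_pow_left (by omega) a
      _ ≤ (Nat.log 2 N + (a + (j + 1))) ^ (a + (j + 1)) :=
          Nat.pow_le_pow_right (by omega) (by omega)
  have hup : 2 ^ ((Nat.log 2 (2 ^ j * N) + a) ^ a) < 2 ^ N :=
    Nat.pow_lt_pow_right (by norm_num) (hexp.trans_lt hgap)
  have hqp : t (2 ^ j * N) ≤ 2 ^ ((Nat.log 2 (2 ^ j * N) + a) ^ a) := ha _
  omega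

/-- **Settles `stmt-ValiantsHypothesis-5116`** (`RigidMinimalReps.ExpDcGlue`, stated verbatim): an
eventual exponential lower bound `c ^ n ≤ dc(per_n)` (`c > 1` real) implies Valiant's hypothesis
`VP ℂ ≠ VNP ℂ`. By `not_isQPBounded_of_eventually_ge_pow` the function `n ↦ dc(per_n)` is not
quasi-polynomially bounded; `VP ⟹ dc quasi-polynomially bounded`
(`isQPBounded_determinantalComplexity_of_isVPFamily_holds`, BCS 1997 Cor. (21.40)) then says the
permanent family is not a `VP` family, and the hub lemma
`Hub.valiantsHypothesis_of_not_isVPFamily_per` with the renaming bridge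
`mem_VP_ofFintype_iff_holds` and `perFamily_mem_VNP_holds ℂ` (Valiant 1979) concludes. [folklore] -/
theorem expDcGlue_proof :
    Summit.ValiantsHypothesis.ValiantsHypothesis.Theses.RigidMinimalReps.ExpDcGlue := by
  unfold Summit.ValiantsHypothesis.ValiantsHypothesis.Theses.RigidMinimalReps.ExpDcGlue
  rintro ⟨c, hc, hev⟩
  refine Summit.ValiantsHypothesis.Hub.valiantsHypothesis_of_not_isVPFamily_per ?_
    (mem_VP_ofFintype_iff_holds _) (perFamily_mem_VNP_holds ℂ)
  intro hVP
  exact not_isQPBounded_of_eventually_ge_pow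
    (t := fun n => determinantalComplexity (perPoly (Fin n) ℂ)) hc hev
    (isQPBounded_determinantalComplexity_of_isVPFamily_holds _ hVP)

end Summit.ValiantsHypothesis.Theorems

/-! ## Feeding the glue: the middle-binomial form of its premise, and the proved confusion-covering rung

Two suppliers of the PREMISE of `expDcGlue_proof` (an eventual exponential lower bound
`c ^ n ≤ dc(per_n)`, `c > 1`), in the shape consumed by the covering lines of the crux
`OrbitDimensionBound` of route `FreeSubtorus` (stmt-ValiantsHypothesis-16133; crux workfile
`Cruxes/OrbitDimensionBound/Lines/ConfusionLadder.lean`, whose header imports this module); composing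
either with `expDcGlue_proof` gives `VP_ℂ ≠ VNP_ℂ`:

* `exp_le_dc_of_choose_middle_le_dc_mul` — MIDDLE-BINOMIAL form: `C(n, ⌊n/2⌋) ≤ dc(per_n) · 2^{⌊n/2⌋}`
  for all `n ≥ 3` forces `(9/8)^n ≤ dc(per_n)` for `n ≥ 14` (`2^n ≤ (n+1) · C(n, ⌊n/2⌋)` and
  `9^n · 2^{⌊n/2⌋} · (n+1) ≤ 16^n`) — the arithmetic inlined in `Theses.FreeSubtorus.closes`, isolated;
* `exp_le_dc_of_lowConfusion_symmetrisation` — FED BY THE PROVED RUNG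
  `Theorems.FreeSubtorusConfusionCovering.confusionCovering_kappa` (`C(n, ⌊n/2⌋) ≤ m · κ_{⌊n/2⌋}(Λ)`
  for every `T_Λ`-equivariant affine determinantal representation of `per_n` of size `m`, `Λ`
  admissible): if for every `n ≥ 3` every affine determinantal representation of `per_n` can be
  re-realised AT THE SAME SIZE equivariantly under SOME admissible `T_Λ` whose middle-level
  confusion number is `≤ 2^{⌊n/2⌋}`, then `(9/8)^n ≤ dc(per_n)` eventually — the workfile's
  `closes_relaxed` (`OrbitConfusionBound → ConfusionCovering → ValiantsHypothesis`) with its rung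
  premise discharged and its last step left to `expDcGlue_proof`, in `Theorems/` vocabulary
  (`confusionNumber` of `Theorems/FreeSubtorusConfusionCoveringDefs.lean`).

Importing `Theorems.FreeSubtorusConfusionCoveringKappa` for the second supplier also places that
module — with its `aesop` forward rule `choose_middle_le_mul_confusionNumber_of_vp_ne_vnp`, the
kernel-visible on-path lemma `ValiantsHypothesis → ConfusionCovering` — in the import closure of the
workfile's header, i.e. in the default scope of the D-0034 forward probe of that rung.
[cite: LandsbergRessayre2017, Thm. 2.8, §6, Question 2.2] [cite: Burgisser2000, Thm. 2.10]
[cite: BurgisserClausenShokrollahi1997, Cor. (21.40)]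
-/

namespace Summit.ValiantsHypothesis.Theorems

open Literature.Computability.AlgebraicComplexity

/-- `162^j · (2j + 2) ≤ 256^j` for `j ≥ 7` (linear versus exponential). [folklore] -/
theorem pow_162_mul_le_pow_256 (j : ℕ) (hj : 7 ≤ j) : 162 ^ j * (2 * j + 2) ≤ 256 ^ j := by
  induction j, hj using Nat.le_induction with
  | base => norm_num
  | succ j _hj ih =>
    have h1 : 162 * (2 * (j + 1) + 2) ≤ 256 * (2 * j + 2) := by omega
    calc 162 ^ (j + 1) * (2 * (j + 1) + 2) = 162 ^ j * (162 * (2 * (j + 1) + 2)) := by ring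
      _ ≤ 162 ^ j * (256 * (2 * j + 2)) := Nat.mul_le_mul_left _ h1
      _ = 256 * (162 ^ j * (2 * j + 2)) := by ring
      _ ≤ 256 * 256 ^ j := Nat.mul_le_mul_left _ ih
      _ = 256 ^ (j + 1) := by ring

/-- `9^n · 2^{⌊n/2⌋} · (n + 1) ≤ 16^n` for `n ≥ 14`, i.e. `(9/8)^n · (n + 1) ≤ 2^{⌈n/2⌉}`; by cases on
the parity of `n`, from `pow_162_mul_le_pow_256` (`9² · 2 = 162`, `16² = 256`). [folklore] -/
theorem nine_pow_mul_two_pow_half_mul_succ_le (n : ℕ) (hn : 14 ≤ n) :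
    9 ^ n * 2 ^ (n / 2) * (n + 1) ≤ 16 ^ n := by
  obtain ⟨j, rfl | rfl⟩ := Nat.even_or_odd' n
  · have hj : 7 ≤ j := by omega
    have h := pow_162_mul_le_pow_256 j hj
    have e1 : (2 * j) / 2 = j := by omega
    rw [e1]
    calc 9 ^ (2 * j) * 2 ^ j * (2 * j + 1) = 162 ^ j * (2 * j + 1) := by
            rw [pow_mul]; rw [← mul_pow]; norm_num
      _ ≤ 162 ^ j * (2 * j + 2) := Nat.mul_le_mul_left _ (by omega)
      _ ≤ 256 ^ j := h
      _ = 16 ^ (2 * j) := by rw [pow_mul]; norm_num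
  · have hj : 7 ≤ j := by omega
    have h := pow_162_mul_le_pow_256 j hj
    have e1 : (2 * j + 1) / 2 = j := by omega
    rw [e1]
    calc 9 ^ (2 * j + 1) * 2 ^ j * (2 * j + 1 + 1) = 9 * (162 ^ j * (2 * j + 2)) := by
            rw [pow_succ, pow_mul]; rw [show (9:ℕ) ^ 2 = 81 by norm_num]
            rw [show (81:ℕ) ^ j * 9 * 2 ^ j = 9 * (81 ^ j * 2 ^ j) by ring, ← mul_pow]; norm_num; ring
      _ ≤ 9 * 256 ^ j := Nat.mul_le_mul_left _ h
      _ ≤ 16 * 256 ^ j := Nat.mul_le_mul_right _ (by norm_num)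
      _ = 16 ^ (2 * j + 1) := by rw [pow_succ, pow_mul]; norm_num; ring

/-- **The glue's premise in middle-binomial form.** If `C(n, ⌊n/2⌋) ≤ dc(per_n) · 2^{⌊n/2⌋}` for all
`n ≥ 3`, then `c ^ n ≤ dc(per_n)` eventually for some real `c > 1` (namely `c = 9/8`, from `n = 14` on):
from `2^n ≤ (n+1) · C(n, ⌊n/2⌋)` and `9^n · 2^{⌊n/2⌋} · (n+1) ≤ 16^n`.  This is Steps 2–3 of
`Theses.FreeSubtorus.closes`, isolated; `expDcGlue_proof` then gives `VP_ℂ ≠ VNP_ℂ` (BCS 1997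
Cor. (21.40): `dc` is quasi-polynomially bounded on `VP`; `per ∈ VNP`). [cite: Burgisser2000, Thm. 2.10]
[cite: BurgisserClausenShokrollahi1997, Cor. (21.40)] -/
theorem exp_le_dc_of_choose_middle_le_dc_mul
    (hstep : ∀ n : ℕ, 3 ≤ n →
      n.choose (n / 2) ≤ determinantalComplexity (perPoly (Fin n) ℂ) * 2 ^ (n / 2)) :
    ∃ c : ℝ, 1 < c ∧ ∃ n₀ : ℕ, ∀ n ≥ n₀,
      c ^ n ≤ (determinantalComplexity (perPoly (Fin n) ℂ) : ℝ) := by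
  -- `(9/8)^n ≤ dc(per_n)` for `n ≥ 14`
  refine ⟨9 / 8, by norm_num, 14, fun n hn => ?_⟩
  have h14 : (3 : ℕ) ≤ n := le_trans (by norm_num) hn
  have hs := hstep n h14
  have hA := nine_pow_mul_two_pow_half_mul_succ_le n hn
  -- `2^n ≤ (n + 1) · C(n, ⌊n/2⌋)`: the `n + 1` binomial coefficients sum to `2^n`, each at most the middle one
  -- (in the tree as `…Theorems.ChowBorderBound.FanInTwoRung.two_pow_le_succ_mul_choose_middle`; four lines,
  -- repeated here rather than importing the `ChowBorderDepth3` chain into this glue module)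
  have hB : 2 ^ n ≤ (n + 1) * n.choose (n / 2) :=
    calc 2 ^ n = ∑ k ∈ Finset.range (n + 1), n.choose k := (Nat.sum_range_choose n).symm
      _ ≤ ∑ _k ∈ Finset.range (n + 1), n.choose (n / 2) :=
          Finset.sum_le_sum fun k _ => Nat.choose_le_middle k n
      _ = (n + 1) * n.choose (n / 2) := by simp
  set D : ℕ := determinantalComplexity (perPoly (Fin n) ℂ) with hD
  have hsR : (n.choose (n / 2) : ℝ) ≤ (D : ℝ) * (2 : ℝ) ^ (n / 2) := by exact_mod_cast hs
  have hAR : (9 : ℝ) ^ n * (2 : ℝ) ^ (n / 2) * ((n : ℝ) + 1) ≤ (16 : ℝ) ^ n := by exact_mod_cast hA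
  have hBR : (2 : ℝ) ^ n ≤ ((n : ℝ) + 1) * (n.choose (n / 2) : ℝ) := by exact_mod_cast hB
  have hposn : (0 : ℝ) < (n : ℝ) + 1 := by positivity
  have h8 : (0 : ℝ) < (8 : ℝ) ^ n := by positivity
  have key : (9 / 8 : ℝ) ^ n * ((8 : ℝ) ^ n * (2 : ℝ) ^ (n / 2) * ((n : ℝ) + 1)) ≤
      (D : ℝ) * ((8 : ℝ) ^ n * (2 : ℝ) ^ (n / 2) * ((n : ℝ) + 1)) := by
    have e1 : (9 / 8 : ℝ) ^ n * ((8 : ℝ) ^ n * (2 : ℝ) ^ (n / 2) * ((n : ℝ) + 1)) =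
        (9 : ℝ) ^ n * (2 : ℝ) ^ (n / 2) * ((n : ℝ) + 1) := by
      rw [div_pow]; field_simp
    have e2 : (16 : ℝ) ^ n = (8 : ℝ) ^ n * (2 : ℝ) ^ n := by
      rw [← mul_pow]; norm_num
    rw [e1]
    calc (9 : ℝ) ^ n * (2 : ℝ) ^ (n / 2) * ((n : ℝ) + 1) ≤ (16 : ℝ) ^ n := hAR
      _ = (8 : ℝ) ^ n * (2 : ℝ) ^ n := e2
      _ ≤ (8 : ℝ) ^ n * (((n : ℝ) + 1) * (n.choose (n / 2) : ℝ)) :=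
          mul_le_mul_of_nonneg_left hBR h8.le
      _ ≤ (8 : ℝ) ^ n * (((n : ℝ) + 1) * ((D : ℝ) * (2 : ℝ) ^ (n / 2))) := by
          apply mul_le_mul_of_nonneg_left _ h8.le
          exact mul_le_mul_of_nonneg_left hsR hposn.le
      _ = (D : ℝ) * ((8 : ℝ) ^ n * (2 : ℝ) ^ (n / 2) * ((n : ℝ) + 1)) := by ring
  have hposP : (0 : ℝ) < (8 : ℝ) ^ n * (2 : ℝ) ^ (n / 2) * ((n : ℝ) + 1) := by positivity
  exact le_of_mul_le_mul_right key hposP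

/-- **The glue's premise fed by the proved confusion-covering rung** (route `FreeSubtorus`, crux
`OrbitDimensionBound`).  Suppose that for every `n ≥ 3` every affine determinantal representation `A`
of `per_n` of size `m` can be replaced by one, `B`, of the same size that is `T_Λ`-equivariant with
exact `GL_m × GL_m` lifts for SOME admissible `Λ : Fin r → ([n] ⊔ [n]) → ℤ` (row sums and column sums
of every `Λ_i` vanish; any number `r` of generators, any rank) whose middle-level confusion number
satisfies `κ_{⌊n/2⌋}(Λ) ≤ 2^{⌊n/2⌋}`.  Then `c ^ n ≤ dc(per_n)` eventually for some real `c > 1` (so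
`VP_ℂ ≠ VNP_ℂ` by `expDcGlue_proof`): take `A` optimal (`hasDetRepr_determinantalComplexity_holds`,
size `dc(per_n)`); the PROVED rung `FreeSubtorusConfusionCovering.confusionCovering_kappa` gives
`C(n, ⌊n/2⌋) ≤ dc(per_n) · κ_{⌊n/2⌋}(Λ) ≤ dc(per_n) · 2^{⌊n/2⌋}`, and
`exp_le_dc_of_choose_middle_le_dc_mul` concludes.  (The hypothesis is the crux workfile's
`Confusion.OrbitConfusionBound` in `Theorems/` vocabulary; the route's own `OrbitDimensionBound` —
admissible `Λ` with `r ≤ n/2` — implies it through Odlyzko's bound `κ ≤ 2^r`,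
`FreeSubtorusConfusionCovering.confusionNumber_le_two_pow`.)
[cite: LandsbergRessayre2017, Thm. 2.8, §6, Question 2.2] [cite: Odlyzko1988, p. 127] -/
theorem exp_le_dc_of_lowConfusion_symmetrisation
    (hsym : ∀ n : ℕ, 3 ≤ n → ∀ (m : ℕ) (A : Matrix (Fin m) (Fin m) (MvPolynomial (Fin n × Fin n) ℂ)),
      IsAffineDetRepr (perPoly (Fin n) ℂ) A →
      ∃ (B : Matrix (Fin m) (Fin m) (MvPolynomial (Fin n × Fin n) ℂ)) (r : ℕ)
        (Λ : Fin r → (Fin n ⊕ Fin n) → ℤ),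
        Summit.ValiantsHypothesis.ValiantsHypothesis.Theorems.FreeSubtorusConfusionCovering.confusionNumber
            n r Λ (n / 2) ≤ 2 ^ (n / 2) ∧
        (∀ i, (∑ k, Λ i (Sum.inl k)) = 0 ∧ (∑ l, Λ i (Sum.inr l)) = 0) ∧
        IsEquivariantDetRepr
          (Subgroup.closure {γ : Matrix.GeneralLinearGroup (Fin n × Fin n) ℂ |
            ∃ d e : Fin n → ℂˣ,
              (∀ i, (∏ k, (d k) ^ (Λ i (Sum.inl k))) * (∏ l, (e l) ^ (Λ i (Sum.inr l))) = 1) ∧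
              (γ : Matrix (Fin n × Fin n) (Fin n × Fin n) ℂ) =
                Matrix.diagonal (fun p => (d p.1 : ℂ) * (e p.2 : ℂ))})
          (perPoly (Fin n) ℂ) B) :
    ∃ c : ℝ, 1 < c ∧ ∃ n₀ : ℕ, ∀ n ≥ n₀,
      c ^ n ≤ (determinantalComplexity (perPoly (Fin n) ℂ) : ℝ) := by
  refine exp_le_dc_of_choose_middle_le_dc_mul fun n hn => ?_
  obtain ⟨A, hA⟩ := hasDetRepr_determinantalComplexity_holds (perPoly (Fin n) ℂ)
  obtain ⟨B, r, Λ, hκ, hΛ, hB⟩ := hsym n hn _ A hA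
  exact (Summit.ValiantsHypothesis.ValiantsHypothesis.Theorems.FreeSubtorusConfusionCovering.confusionCovering_kappa
      n hn _ r Λ B hΛ hB).trans (Nat.mul_le_mul_left _ hκ)

end Summit.ValiantsHypothesis.Theorems
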